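import Mathlib
import HarnessLib
import Literature.Probability.Distributions.GaussianMetropolisAcceptance
import Literature.Probability.Distributions.PseudoMarginalGaussianNoise

/-!
# LatticeQCDFlow / Scaling — the Gaussian-work DICTIONARY: `⟨W_d⟩ = s/2`, `ESS = e^{−s}`,
# `acc_NCMC = 2Φ(−√s/2)`, `acc_IMH = 2Φ(−√(s/2))`; frozen exterior `Q`, `e^{−2Q}`, `2Φ(−√(Q/2))`

HONEST FRAMING: exact (Metropolis-corrected) sampling algorithms for lattice gauge theory;
figures of merit are autocorrelation/cost numbers at stated couplings and volumes; no
continuum-physics claim.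

Venture `LatticeQCDFlow` (cell pub-lqcd), topic `Scaling`; FANOUT row 8 (`s0-cpn-nemc`, GEN-8).
NEW WORK of the cell only in the sense of ASSEMBLY: every Gaussian integral below is a published,
already-formalised Literature result — Knechtli–Wolff, Nucl. Phys. B 663 (2003) eq. (3.13)
(`Literature/Probability/Distributions/GaussianMetropolisAcceptance.lean`) and Doucet–Pitt–
Deligiannidis–Kohn, Biometrika 102 (2015) Corollary 3
(`Literature/Probability/Distributions/PseudoMarginalGaussianNoise.lean`) — re-read here in the
vocabulary of non-equilibrium protocols (`Exactness/NCMCAcceptance.lean`,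
`Scaling/StochasticBudgets.lean`) and of the frozen-exterior floor theorem
(`Exactness/FrozenExteriorPenalty / ESS / Marginals / Acceptance.lean`), whose docstrings quote
these values as an untyped "Gaussian dictionary".  No Literature declaration is added.

THE MODEL (a continuum idealisation, NOT a statement about the finite path spaces of the
`Exactness` files — a finite law is never Gaussian): the dissipated work `W_d = W − ΔF` of a
forward evolution has Gaussian law with variance `s`; Jarzynski `⟨e^{−W_d}⟩ = 1` then forces the
mean to be `s/2` (Literature `integral_exp_neg_gaussianReal`; the converse direction is T2-J
`gaussian_logweight_law` of `Scaling/GaussianWeights.lean` with `ℓ = −W_d`), so THE law is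
`gaussianReal (s/2) s`.  `Φ(t)` is written `(gaussianReal 0 1).real (Iic t)`-style as
`(gaussianReal 0 1 (Iic t)).toReal`.

## Content (all proved; `s : ℝ≥0`, `s ≠ 0` where a density is used)

* `gaussianWork_mean` — `⟨W_d⟩ = s/2`: the mean dissipation (= `D(P_F‖P_R)`,
  `Theory2.kl_path_eq_dissipation`) is HALF THE WORK VARIANCE;
* Jarzynski `⟨e^{−W_d}⟩ = 1` is Literature's `integral_exp_neg_gaussianReal` (used, not restated);
  `gaussianWork_secondMoment` — `⟨e^{−2W_d}⟩ = e^{s}`;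
  **`gaussianWork_kishESS`** — `⟨e^{−W_d}⟩²/⟨e^{−2W_d}⟩ = e^{−s} = e^{−2⟨W_d⟩}` (the population
  Kish ESS of `Exactness/BennettAcceptanceRatio.essPop_eq_inv_dissipation` in the model; the
  `ÊSS = e^{−2 D̃_KL}` regularity this row measured on its CP(N−1) cells, RESULTS §7–§8);
* **`gaussianWork_ncmcAcc`** — `⟨min(1, e^{−W_d})⟩ = 2Φ(−√s/2)` (the `erfc(√(s/8))` form is
  Literature's `integral_min_one_exp_neg_gaussianReal_eq_erfc`): the model value of the one-way
  switch acceptance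
  `ncmcAccRate = 1 − TV(P_F, P_R)` of `Exactness/NCMCAcceptance.lean`;
* **`gaussianWork_imhAcc`** — `∬ min(1, e^{w−z}) N(−s/2, s)(dw) N(s/2, s)(dz) = 2Φ(−√(s/2))`: the
  model value of the path-IMH acceptance `accRate P_R P_F` (fresh log-weight `w = −W_d' ∼ N(−s/2,s)`
  against the stationary one `z ∼ N(s/2, s)`, the tilt) — Doucet et al.'s pseudo-marginal formula
  read for NE-MCMC; `gaussianWork_imhAcc_le_ncmcAcc` — `2Φ(−√(s/2)) ≤ 2Φ(−√s/2)`, the model form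
  of the typed `accRate_path_le_ncmcAccRate`;
* frozen exterior, `s = 2Q` (the log-ratio `annealedΔF − ΔF(y)` Gaussian under the prior exterior
  marginal `p`, `Q` = row 13's `frozenExteriorPenalty`): `frozenExteriorGaussian_penalty`
  (`E_p[ΔF − annealedΔF] = Q`), **`frozenExteriorGaussian_ceiling`** (Kish ceiling
  `= e^{−2Q}`), **`frozenExteriorGaussian_cap`** (acceptance cap `1 − TV(π₁^ext, π₀^ext)
  = E_p min(1, π₁/π₀) = 2Φ(−√(Q/2))`) — the three dictionary values quoted in
  `FrozenExteriorESS.lean` / `FrozenExteriorAcceptance.lean` and in the flow seat's BALL-FLOOR §1.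

Numbers (for orientation, not typed): `s = 0.69` (`⟨W_d⟩ = 0.346`, this row's C08-B cell) gives
ESS `0.50`, `acc_NCMC 0.68`, `acc_IMH 0.56`; `Q = 0.29` (row 13's SU(3) ball `r = 1`) gives ceiling
`0.56`, cap `0.70`.
-/

namespace Summit.Ventures.LatticeQCDFlow.Theory2

open MeasureTheory ProbabilityTheory Set
open scoped NNReal ENNReal
open Literature.Probability.Distributions

section GaussianWork

variable {s : ℝ≥0}

/-! ## Moments: mean dissipation, Jarzynski, Kish ESS -/

/-- `⟨W_d⟩ = s/2`: in the Gaussian work model the mean dissipated work — the path-space KL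
`D(P_F‖P_R)` — is half the variance of the work. -/
theorem gaussianWork_mean (s : ℝ≥0) : ∫ x, x ∂(gaussianReal ((s : ℝ) / 2) s) = (s : ℝ) / 2 :=
  integral_id_gaussianReal

/-- Second exponential moment: `⟨e^{−2W_d}⟩ = e^{s}` (Gaussian mgf at `−2`). -/
theorem gaussianWork_secondMoment (s : ℝ≥0) :
    ∫ x, Real.exp (-(2 * x)) ∂(gaussianReal ((s : ℝ) / 2) s) = Real.exp (s : ℝ) := by
  have h := congrFun (mgf_id_gaussianReal (μ := (s : ℝ) / 2) (v := s)) (-2)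
  simp only [mgf, id_eq] at h
  have h' : ∫ x, Real.exp (-(2 * x)) ∂(gaussianReal ((s : ℝ) / 2) s) =
      ∫ x, Real.exp (-2 * x) ∂(gaussianReal ((s : ℝ) / 2) s) := by
    refine integral_congr_ae (ae_of_all _ fun x => ?_)
    simp only [neg_mul]
  rw [h', h]
  congr 1
  ring

/-- **Kish ESS in the model: `⟨e^{−W_d}⟩² / ⟨e^{−2W_d}⟩ = e^{−s} = e^{−2⟨W_d⟩}`** — exponentially
small in the work variance; the NE-MCMC reading of T2-J (`gaussian_logweight_ess`). -/
theorem gaussianWork_kishESS (s : ℝ≥0) :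
    (∫ x, Real.exp (-x) ∂(gaussianReal ((s : ℝ) / 2) s)) ^ 2 /
        ∫ x, Real.exp (-(2 * x)) ∂(gaussianReal ((s : ℝ) / 2) s) = Real.exp (-(s : ℝ)) := by
  rw [integral_exp_neg_gaussianReal, gaussianWork_secondMoment, one_pow, Real.exp_neg, one_div]

/-- The same with the mean dissipation made explicit: `ESS = e^{−2⟨W_d⟩}`. -/
theorem gaussianWork_kishESS_eq_exp_neg_two_mul_mean (s : ℝ≥0) :
    (∫ x, Real.exp (-x) ∂(gaussianReal ((s : ℝ) / 2) s)) ^ 2 /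
        ∫ x, Real.exp (-(2 * x)) ∂(gaussianReal ((s : ℝ) / 2) s) =
      Real.exp (-(2 * ∫ x, x ∂(gaussianReal ((s : ℝ) / 2) s))) := by
  rw [gaussianWork_kishESS, gaussianWork_mean]
  congr 1
  ring

/-! ## Acceptances: one-way switch `2Φ(−√s/2)`, path-IMH `2Φ(−√(s/2))` -/

/-- `(0 − s/2)/√s = −(√s/2)` (standardisation arithmetic). -/
private theorem std_point (s : ℝ≥0) : (0 - (s : ℝ) / 2) / Real.sqrt (s : ℝ) = -(Real.sqrt (s : ℝ) / 2) := by
  rw [zero_sub, neg_div, div_right_comm, Real.div_sqrt]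

/-- **One-way NCMC switch in the model: `⟨min(1, e^{−W_d})⟩ = 2Φ(−√s/2)`** — Knechtli–Wolff's
Metropolis formula read for the Crooks acceptance `min(1, e^{−(W − ΔF)})`
(`Exactness/NCMCAcceptance.ncmcAccRate`; there `= 1 − TV(P_F, P_R)` exactly). -/
theorem gaussianWork_ncmcAcc (hs : s ≠ 0) :
    ∫ x, min 1 (Real.exp (-x)) ∂(gaussianReal ((s : ℝ) / 2) s) =
      2 * (gaussianReal 0 1 (Iic (-(Real.sqrt (s : ℝ) / 2)))).toReal := by
  rw [integral_min_one_exp_neg_gaussianReal hs,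
    PseudoMarginalNoise.gaussianReal_Iic_eq_std ((s : ℝ) / 2) hs 0, std_point]

/-- **Path-IMH in the model: `∬ min(1, e^{w − z}) N(−s/2, s)(dw) N(s/2, s)(dz) = 2Φ(−√(s/2))`** —
the fresh evolution's log-weight `w = −W_d'` has the forward law `N(−s/2, s)`, the current one `z`
the tilted (stationary) law `N(s/2, s)`; Doucet et al.'s pseudo-marginal Corollary 3 read for the
path independence sampler (`accRate P_R P_F`). -/
theorem gaussianWork_imhAcc (hs : s ≠ 0) :
    ∫ z, ∫ w, min 1 (Real.exp (w - z)) ∂(gaussianReal (-((s : ℝ) / 2)) s)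
        ∂(gaussianReal ((s : ℝ) / 2) s) =
      2 * (gaussianReal 0 1 (Iic (-(Real.sqrt (s : ℝ) / Real.sqrt 2)))).toReal := by
  have h := PseudoMarginalNoise.integral_noiseAccept_eq_two_mul_cdf hs
  rwa [PseudoMarginalNoise.noiseLaw, PseudoMarginalNoise.tiltedLaw] at h

/-- `√2 ≤ 2`. -/
private theorem sqrt_two_le_two : Real.sqrt 2 ≤ 2 := by
  nlinarith [Real.sq_sqrt (show (0 : ℝ) ≤ 2 by norm_num), Real.sqrt_nonneg 2]

/-- **`acc_IMH ≤ acc_NCMC` in the model: `2Φ(−√(s/2)) ≤ 2Φ(−√s/2)`** (`√s/2 ≤ √s/√2`) — the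
Gaussian value of the typed, distribution-free `Exactness/NCMCAcceptance.accRate_path_le_ncmcAccRate`. -/
theorem gaussianWork_imhAcc_le_ncmcAcc (s : ℝ≥0) :
    2 * (gaussianReal 0 1 (Iic (-(Real.sqrt (s : ℝ) / Real.sqrt 2)))).toReal ≤
      2 * (gaussianReal 0 1 (Iic (-(Real.sqrt (s : ℝ) / 2)))).toReal := by
  have hle : -(Real.sqrt (s : ℝ) / Real.sqrt 2) ≤ -(Real.sqrt (s : ℝ) / 2) :=
    neg_le_neg (div_le_div_of_nonneg_left (Real.sqrt_nonneg _) (Real.sqrt_pos.mpr two_pos)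
      sqrt_two_le_two)
  exact mul_le_mul_of_nonneg_left
    (ENNReal.toReal_mono (measure_ne_top _ _) (measure_mono (Iic_subset_Iic.mpr hle))) zero_le_two

/-! ## Frozen exterior: `s = 2Q` -/

/-- `((2Q : ℝ≥0) : ℝ)/2 = Q`. -/
private theorem two_mul_half (Q : ℝ≥0) : (((2 * Q : ℝ≥0) : ℝ)) / 2 = (Q : ℝ) := by
  push_cast; ring

/-- Frozen-exterior dictionary, first moment: if under the prior exterior marginal `p` the log-ratio
`ΔF(y) − annealedΔF` is Gaussian with variance `2Q` (mean then forced to `Q` by normalisation of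
`π₁^ext = p·e^{annealedΔF − ΔF}`), its mean — row 13's `frozenExteriorPenalty`
`Q = Σ p ΔF − annealedΔF = KL(π₀^ext‖π₁^ext)` — is `Q`: penalty = half the variance of `ΔF(y)`. -/
theorem frozenExteriorGaussian_penalty (Q : ℝ≥0) :
    ∫ x, x ∂(gaussianReal (Q : ℝ) (2 * Q)) = (Q : ℝ) := by
  have h := gaussianWork_mean (2 * Q)
  rwa [two_mul_half] at h

/-- **Frozen-exterior dictionary, Kish ceiling `= e^{−2Q}`**: `CEILING = (Σ p e^{−ΔF})²/Σ p e^{−2ΔF}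
= e^{−D₂(π₁^ext‖π₀^ext)}` (`frozenExteriorEssCeiling_eq_inv`) takes the value `e^{−2Q}` in the
Gaussian model — the flow seat's "Gaussian regime ESS factor `e^{−2Q}`" (0.56 at `Q = 0.29`). -/
theorem frozenExteriorGaussian_ceiling (Q : ℝ≥0) :
    (∫ x, Real.exp (-x) ∂(gaussianReal (Q : ℝ) (2 * Q))) ^ 2 /
        ∫ x, Real.exp (-(2 * x)) ∂(gaussianReal (Q : ℝ) (2 * Q)) = Real.exp (-(2 * (Q : ℝ))) := by
  have h := gaussianWork_kishESS (2 * Q)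
  rw [two_mul_half] at h
  rw [h]
  push_cast
  ring_nf

/-- `√(2Q)/2 = √(Q/2)`. -/
private theorem sqrt_two_mul_div_two (Q : ℝ≥0) :
    Real.sqrt (((2 * Q : ℝ≥0) : ℝ)) / 2 = Real.sqrt ((Q : ℝ) / 2) := by
  push_cast
  rw [show (Q : ℝ) / 2 = 2 * (Q : ℝ) / 4 by ring, Real.sqrt_div' _ (by norm_num : (0 : ℝ) ≤ 4),
    show (4 : ℝ) = 2 ^ 2 by norm_num, Real.sqrt_sq zero_le_two]

/-- **Frozen-exterior dictionary, acceptance cap `= 2Φ(−√(Q/2))`**: `1 − TV(π₁^ext, π₀^ext)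
= E_p min(1, π₁^ext/π₀^ext) = E min(1, e^{−X})`, `X = ΔF(y) − annealedΔF ∼ N(Q, 2Q)`, takes the
value `2Φ(−√(Q/2))` (0.70 at `Q = 0.29`) — the cap shared by path-IMH
(`accRate_frozen_le_one_sub_tvDist`) and the one-way switch (`sum_min_frozen_le_one_sub_tvDist`). -/
theorem frozenExteriorGaussian_cap {Q : ℝ≥0} (hQ : Q ≠ 0) :
    ∫ x, min 1 (Real.exp (-x)) ∂(gaussianReal (Q : ℝ) (2 * Q)) =
      2 * (gaussianReal 0 1 (Iic (-Real.sqrt ((Q : ℝ) / 2)))).toReal := by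
  have h2Q : (2 * Q : ℝ≥0) ≠ 0 := mul_ne_zero two_ne_zero hQ
  have h := gaussianWork_ncmcAcc h2Q
  rwa [two_mul_half, sqrt_two_mul_div_two] at h

end GaussianWork

end Summit.Ventures.LatticeQCDFlow.Theory2
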